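import Literature.Analysis.FluidPDE.FiniteFourierModeEulerPlanarPolyB
import Literature.Analysis.FluidPDE.FiniteFourierModeEulerPlanarVert

/-!
# Kishimoto–Yoneda §3 (planar case): the transport operator and the powers of `ω`

Support file for `FiniteFourierModeEuler` (N. Kishimoto, T. Yoneda, J. Math. Fluid Mech. 24
(2022) 74 = arXiv:2110.08039), §3 proof of Prop. 3.1 (ii). On finitely supported Fourier
coefficient functions `φ : ℝ³ → ℂ` the vertical transport `(u^∥·∇)` acts as
`(A φ)_n = i Σ_{n' ∈ S_∥} τ(n', n - n') α_{n'} φ_{n-n'}` (`convOp`,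
`FiniteFourierModeEulerPlanarVert`). The Fourier coefficients of the
powers `ω^q` of `ω(x) = Σ_j iα_j e^{i n_j·x}` are the iterated convolutions `Omega q`
(`Ω₀ = δ₀`, `Ω_{q+1}(n) = Σ_{m ∈ S_∥} iα_m Ω_q(n - m)`), and the identity
`(u^∥·∇) ω^q = q ω^{q-1} (u^∥·∇ω) = 0` ((eq:polyom): "since `e^∥_j·n_l = -e^∥_l·n_j`") becomes
`A (Omega q) = 0` (`convOp_Omega`), proved by the Leibniz rule for `A` and the antisymmetry of `τ`.
We also bound the support of `Omega q` by the gauge, `N ≤ q`, and compute `Omega q (q V₀) = (iα₀)^q`.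

## References

* [KishimotoYoneda2022] N. Kishimoto, T. Yoneda, J. Math. Fluid Mech. 24 (2022) 74 =
  arXiv:2110.08039, §3 proof of Prop. 3.1 (ii): (cond:Euler^h), the expansion of `ω^q`, (eq:polyom).
-/

noncomputable section

open Matrix Finset Complex

namespace Literature.Analysis.FluidPDE

namespace KY

open scoped Classical

/-- The Fourier coefficients of `ω^q`, `ω = Σ_{m ∈ T} iα_m e^{im·x}`: iterated convolution.
[cite: KishimotoYoneda2022, §3 proof of Prop. 3.1 (ii) (the expansion of `ω(x)^q`)] -/
def Omega (T : Finset (Fin 3 → ℝ)) (α : (Fin 3 → ℝ) → ℂ) : ℕ → (Fin 3 → ℝ) → ℂ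
  | 0 => fun n => if n = 0 then 1 else 0
  | q + 1 => fun n => ∑ m ∈ T, (Complex.I * α m) * Omega T α q (n - m)

section Ops

variable (T : Finset (Fin 3 → ℝ)) (e : Fin 3 → ℝ) (α : (Fin 3 → ℝ) → ℂ)

/-- Bookkeeping for the transport operator / `Ω_q`: `Omega_zero`. [folklore] -/
theorem Omega_zero (n : Fin 3 → ℝ) : Omega T α 0 n = if n = 0 then 1 else 0 := rfl

/-- Bookkeeping for the transport operator / `Ω_q`: `Omega_succ`. [folklore] -/
theorem Omega_succ (q : ℕ) (n : Fin 3 → ℝ) :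
    Omega T α (q + 1) n = ∑ m ∈ T, (Complex.I * α m) * Omega T α q (n - m) := rfl

/-- A sum over `T × T` of an antisymmetric summand vanishes. [folklore] -/
theorem sum_prod_antisymm (f : (Fin 3 → ℝ) → (Fin 3 → ℝ) → ℂ) (hf : ∀ a b, f b a = -f a b) :
    ∑ a ∈ T, ∑ b ∈ T, f a b = 0 := by
  have h1 : ∑ a ∈ T, ∑ b ∈ T, f a b = ∑ b ∈ T, ∑ a ∈ T, f a b := Finset.sum_comm
  have h2 : ∑ b ∈ T, ∑ a ∈ T, f a b = -∑ b ∈ T, ∑ a ∈ T, f b a := by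
    rw [← Finset.sum_neg_distrib]
    refine Finset.sum_congr rfl fun b _ => ?_
    rw [← Finset.sum_neg_distrib]
    refine Finset.sum_congr rfl fun a _ => ?_
    rw [hf b a]
  rw [h2] at h1
  have : (2 : ℂ) * ∑ a ∈ T, ∑ b ∈ T, f a b = 0 := by rw [two_mul]; nth_rewrite 2 [h1]; ring
  exact (mul_eq_zero.1 this).resolve_left two_ne_zero

/-- `A Ω₁ = 0`: the pair terms are antisymmetric. [cite: KishimotoYoneda2022, §3 (eq:polyom) ("since `e^∥_j·n_l = -e^∥_l·n_j`")] -/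
theorem convOp_Omega_one (n : Fin 3 → ℝ) : convOp T e α (Omega T α 1) n = 0 := by
  unfold convOp
  rw [mul_eq_zero]; right
  simp only [Omega_succ, Omega_zero, Finset.mul_sum]
  -- `Σ_{m} Σ_{m'} pc(m, n-m) α_m (iα_{m'}) [n - m - m' = 0]`
  have : ∀ m ∈ T, ∑ m' ∈ T, ((pc e m (n - m) : ℝ) : ℂ) * α m * (Complex.I * α m' * if n - m - m' = 0 then 1 else 0)
      = ∑ m' ∈ T, (if m + m' = n then Complex.I * ((pc e m m' : ℝ) : ℂ) * α m * α m' else 0) := by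
    intro m _
    refine Finset.sum_congr rfl fun m' _ => ?_
    by_cases h : m + m' = n
    · have h' : n - m - m' = 0 := by rw [← h]; abel
      rw [if_pos h', if_pos h, show n - m = m' by rw [← h]; abel]; ring
    · have h' : n - m - m' ≠ 0 := by intro h0; apply h; rw [sub_sub, sub_eq_zero] at h0; exact h0.symm
      rw [if_neg h', if_neg h]; ring
  rw [Finset.sum_congr rfl this]
  apply sum_prod_antisymm
  intro a b
  by_cases h : a + b = n
  · rw [if_pos h, if_pos (by rw [add_comm]; exact h), pc_anticomm]; push_cast; ring
  · rw [if_neg h, if_neg (by rw [add_comm]; exact h), neg_zero]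

/-- **The Leibniz rule for `A` along the convolution recursion.**
`A(Ω_{q+1})_n = i Σ_{m,m'} τ(m, m') α_m (iα_{m'}) Ω_q(n-m-m') + Σ_{m'} iα_{m'} (A Ω_q)_{n-m'}`. [folklore] -/
theorem convOp_Omega_succ (q : ℕ) (n : Fin 3 → ℝ) :
    convOp T e α (Omega T α (q + 1)) n
      = Complex.I * ∑ m ∈ T, ∑ m' ∈ T,
          ((pc e m m' : ℝ) : ℂ) * α m * (Complex.I * α m') * Omega T α q (n - m - m')
        + ∑ m' ∈ T, (Complex.I * α m') * convOp T e α (Omega T α q) (n - m') := by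
  unfold convOp
  simp only [Omega_succ]
  -- split `pc(m, n - m) = pc(m, m') + pc(m, n - m - m')`
  have hsplit : ∀ m ∈ T, ((pc e m (n - m) : ℝ) : ℂ) * α m * ∑ m' ∈ T, Complex.I * α m' * Omega T α q (n - m - m')
      = ∑ m' ∈ T, ((pc e m m' : ℝ) : ℂ) * α m * (Complex.I * α m') * Omega T α q (n - m - m')
        + ∑ m' ∈ T, ((pc e m (n - m - m') : ℝ) : ℂ) * α m * (Complex.I * α m') * Omega T α q (n - m - m') := by
    intro m _
    rw [Finset.mul_sum, ← Finset.sum_add_distrib]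
    refine Finset.sum_congr rfl fun m' _ => ?_
    have : pc e m (n - m) = pc e m m' + pc e m (n - m - m') := by
      rw [← pc_add_right]; congr 1; abel
    rw [this]; push_cast; ring
  rw [Finset.sum_congr rfl hsplit, Finset.sum_add_distrib, mul_add]
  congr 1
  rw [Finset.mul_sum]
  simp only [Finset.mul_sum]
  rw [Finset.sum_comm]
  refine Finset.sum_congr rfl fun m' _ => ?_
  refine Finset.sum_congr rfl fun m _ => ?_
  rw [show n - m - m' = n - m' - m by abel]; ring

/-- **`(u^∥·∇) ω^q = 0` on the Fourier side: `A (Ω_q) = 0`.** [cite: KishimotoYoneda2022, §3 (eq:polyom)] -/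
theorem convOp_Omega (q : ℕ) (n : Fin 3 → ℝ) : convOp T e α (Omega T α q) n = 0 := by
  induction q generalizing n with
  | zero =>
    -- `Ω₀ = δ₀`: `pc(m, 0) … `; the only term has `n - m = 0`, i.e. `pc(m, 0) = 0`
    unfold convOp
    rw [mul_eq_zero]; right
    apply Finset.sum_eq_zero
    intro m _
    simp only [Omega_zero]
    by_cases h : n - m = 0
    · rw [h, if_pos rfl]; unfold pc; rw [cross_apply]; simp [dotProduct, Fin.sum_univ_three]
    · rw [if_neg h]; ring
  | succ q ih =>
    rw [convOp_Omega_succ]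
    simp only [ih, mul_zero, Finset.sum_const_zero, add_zero]
    rw [mul_eq_zero]; right
    apply sum_prod_antisymm
    intro a b
    rw [pc_anticomm, show n - b - a = n - a - b by abel]; push_cast; ring

/-- `Ω_q` has finite support (the `q`-fold sums of points of `T`). [folklore] -/
theorem Omega_support (q : ℕ) : ∃ G : Finset (Fin 3 → ℝ), ∀ n, Omega T α q n ≠ 0 → n ∈ G := by
  induction q with
  | zero => refine ⟨{0}, fun n hn => ?_⟩; rw [Omega_zero] at hn; by_cases h : n = 0
            · rw [h]; exact Finset.mem_singleton_self 0
            · rw [if_neg h] at hn; exact absurd rfl hn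
  | succ q ih =>
    obtain ⟨G, hG⟩ := ih
    refine ⟨(G ×ˢ T).image fun p => p.1 + p.2, fun n hn => ?_⟩
    rw [Omega_succ] at hn
    obtain ⟨m, hm, hne⟩ := Finset.exists_ne_zero_of_sum_ne_zero hn
    have h1 : Omega T α q (n - m) ≠ 0 := fun h0 => hne (by rw [h0, mul_zero])
    rw [Finset.mem_image]
    exact ⟨(n - m, m), Finset.mem_product.2 ⟨hG _ h1, hm⟩, by simp⟩

end Ops

/-! ### Support of `Ω_q` versus the gauge -/

namespace PolyCfg

variable {T : Finset (Fin 3 → ℝ)} {e : Fin 3 → ℝ} (P : PolyCfg T e) (α : (Fin 3 → ℝ) → ℂ)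
include P

/-- Points in the support of `Ω_q` are planar. [folklore] -/
theorem Omega_plane {q : ℕ} {n : Fin 3 → ℝ} (h : Omega T α q n ≠ 0) : e ⬝ᵥ n = 0 := by
  induction q generalizing n with
  | zero =>
    rw [Omega_zero] at h
    by_cases hn : n = 0
    · rw [hn, dotProduct_zero]
    · rw [if_neg hn] at h; exact absurd rfl h
  | succ q ih =>
    rw [Omega_succ] at h
    obtain ⟨m, hm, hne⟩ := Finset.exists_ne_zero_of_sum_ne_zero h
    have h1 : Omega T α q (n - m) ≠ 0 := fun h0 => hne (by rw [h0, mul_zero])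
    have h2 := ih h1
    rw [dotProduct_sub, P.plane m hm, sub_zero] at h2
    exact h2

/-- **`supp Ω_q ⊆ {N ≤ q}`.** [cite: KishimotoYoneda2022, §3 proof of Lemma 3.3 ("`η_q` … Fourier support … contained in `{N < q}`")] -/
theorem Nf_le_of_Omega_ne_zero {q : ℕ} {n : Fin 3 → ℝ} (h : Omega T α q n ≠ 0) : P.Nf n ≤ q := by
  induction q generalizing n with
  | zero =>
    rw [Omega_zero] at h
    by_cases hn : n = 0
    · rw [hn]; simp [Nf_le_iff]
    · rw [if_neg hn] at h; exact absurd rfl h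
  | succ q ih =>
    rw [Omega_succ] at h
    obtain ⟨m, hm, hne⟩ := Finset.exists_ne_zero_of_sum_ne_zero h
    have h1 : Omega T α q (n - m) ≠ 0 := fun h0 => hne (by rw [h0, mul_zero])
    have h2 := ih h1
    have h3 := P.Nf_le_one hm
    have : n = m + (n - m) := by abel
    rw [this]
    calc P.Nf (m + (n - m)) ≤ P.Nf m + P.Nf (n - m) := P.Nf_add_le _ _
      _ ≤ 1 + q := add_le_add h3 h2
      _ = (q + 1 : ℕ) := by push_cast; ring

/-- **The vertex coefficient `Ω_q(q V₀) = (iα₀)^q`**: the only way to write `q V₀` as a sum of `q`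
points of `T` uses `V₀` only. [cite: KishimotoYoneda2022, §3 proof of Lemma 3.3 ("the only possible pair … is `(n₀, (q-1)n₀)`")] -/
theorem Omega_vertex (hside : ∀ s ∈ T, s ≠ P.V 0 → P.gV 0 s < 1) (q : ℕ) :
    Omega T α q ((q : ℝ) • P.V 0) = (Complex.I * α (P.V 0)) ^ q := by
  induction q with
  | zero => simp [Omega_zero]
  | succ q ih =>
    rw [Omega_succ, Finset.sum_eq_single (P.V 0)]
    · rw [show ((q + 1 : ℕ) : ℝ) • P.V 0 - P.V 0 = (q : ℝ) • P.V 0 by push_cast; rw [add_smul, one_smul, add_sub_cancel_right],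
        ih, pow_succ]; ring
    · intro m hm hne
      -- `Ω_q((q+1)V₀ - m) = 0` since its gauge exceeds `q`
      have hg := hside m hm hne
      by_contra hne0
      have h1 : Omega T α q (((q + 1 : ℕ) : ℝ) • P.V 0 - m) ≠ 0 := fun h0 => hne0 (by rw [h0, mul_zero])
      have h2 := P.Nf_le_of_Omega_ne_zero α h1
      have h3 : P.gV 0 (((q + 1 : ℕ) : ℝ) • P.V 0 - m) ≤ P.Nf (((q + 1 : ℕ) : ℝ) • P.V 0 - m) := by
        unfold gV
        have := P.fE_le_Nf (0 + P.m) (((q + 1 : ℕ) : ℝ) • P.V 0 - m)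
        have := P.fE_le_Nf 0 (((q + 1 : ℕ) : ℝ) • P.V 0 - m)
        linarith
      rw [P.gV_sub, P.gV_smul, P.gV_V_self] at h3
      push_cast at h3 h2
      linarith
    · intro h; exact absurd (P.V_mem 0) h

end PolyCfg

end KY

end Literature.Analysis.FluidPDE
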